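/-
Copyright (c) 2026. All rights reserved.
Released under Apache 2.0 license as described in the file LICENSE.
Authors: abc-iut cell, statement-typer seat abc-iut-L4-t3 (wave 1); `⋉`-twin re-elaborated by prover seat abc-iut-L4-t11
(gen 15) per the cell recipe LTIMES-RECIPE (owner abc-iut-L4-t3), statements unchanged.
-/
import Literature.AnabelianGeometry.AbsoluteAnabelian.Ltimes.LogFrobeniusRigidity
import Literature.AnabelianGeometry.AbsoluteAnabelian.LogFrobeniusObservables
import HarnessLib

/-!
# [AbsTopIII] Corollary 5.5 (iii), `TS`-valued half, and Corollary 5.5 (iv), first sentence in full: the observable `S_log` and the log-wall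

S. Mochizuki, *Topics in absolute anabelian geometry III: global reconstruction algorithms*,
J. Math. Sci. Univ. Tokyo 22 (2015) 939–1156 [MochizukiAbsTopIII2015]; locators `p.N` = pages of the
author's manuscript (`paper:url-5493eb38cbb7`), read on the page: Def 5.4 (vii) p. 128 (`ι_{v,ε}`), Cor 5.5 (iii), (iv)
p. 131.

Completion of `LogFrobeniusCorollaries.lean` (seat abc-iut-L4-t3), which typed the `⊞`-half `S_log⊞` of Cor 5.5 (iii) and,
accordingly, Cor 5.5 (iv) against `S_log⊞` only (disclosed there as formally STRONGER than print, referee K1-F1). Here: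
* Def 5.4 (vii), `TS`-valued half — the natural transformations `ι_{v,ε} : λ_{v,ν₁} ∘ Λ_{ν₁} → λ_{v,ν₂}` for EVERY edge `ε` of
  `Γ⃗^log_v` (`λ_{v,ν} = λ⊞_{v,ν}` composed with `𝒩⊞_v → 𝒩_v`): the INTERFACE `LogFrobeniusSetting.TSHomotopies L` (one extra
  datum beyond `L.iota` — at the arrows of `Γ⃗^log_v` not in `Γ⃗^⋉_v`, i.e. the space-link arrow `k̄^× ↪ k̄` at nonarchimedean
  `v` — together with the requirement that on `Γ⃗^⋉_v` it is `ι⊞_{v,ε}` pushed down to `𝒩_v`);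
* Cor 5.5 (iii), `TS`-half (paraphrase of the "respectively" reading of p. 131: the `ι_{v,ε}` belong to a family of
  homotopies on `D•_{≤4}` that determines on the portion of `D•_{≤4}` indexed by `v` a structure of observable `S_log` on the
  portion of `D•_{≤3}` indexed by `v`) = `IsLogObservableTS` / `Cor55ObservablesTS`; "the families of homotopies that
  constitute `S_log` and `S_log⊞` are compatible with one another as well as with the families of homotopies that
  constitute the core and telecore structures of (i), (ii)" = `Cor55ObservablesCompatible` for the core part (compatibility
  with the telecore family of (ii) is not typed — TODO(general form), as in `LogFrobeniusCorollaries.lean`);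
* Cor 5.5 (iv), first sentence, PRINT-FAITHFUL: "`D•_{≤2}` does not admit a structure of core on `D•_{≤1}` which [i.e., whose
  constituent family of homotopies] is compatible with [the constituent families of homotopies of] the observables
  `S_log`, `S_log⊞` of (iii)" = `Cor55LogWall` (both observables; `Cor55Incompatibility` of `LogFrobeniusCorollaries.lean`
  is the `S_log⊞`-only, formally stronger variant). The second sentence of (iv) (`𝔗_{An•}`, `ℋ_{An•}` and the observables
  not simultaneously compatible) needs the contact structure with PINNED generators `η_{□⋎}`, `η_⋏`; it stays
  TODO(general form).
Every `Prop` is an ASSUMPTION on `(L, T)` asserted by the text for the genuine theaters. Refereed pre-IUT material;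
nothing here bears on [IUTchIII] Cor. 3.12; typed ≠ discharged.

**`⋉`-TWIN (cell row «LTIMES-SUCCESSOR», L4-lead m162; typing finding T3g9-F1).**  This file is the verbatim
re-elaboration of `LogFrobeniusObservables.lean` over the successor interface `LogFrobeniusSettingLtimes`
(`Ltimes/LogFrobeniusCompatibility.lean`: `ι⊞_{v,ε}` indexed by the edges of `Γ⃗^⋉_v` at EVERY place, [AbsTopIII] Cor 5.5 (iii)
p. 131), produced by the cell recipe `LTIMES-RECIPE.md`: names carry over inside `namespace LogFrobeniusSettingLtimes`, the
section variable is `Lt`, setting-independent declarations are NOT repeated (the originals are in scope), statements and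
proofs are otherwise unchanged.  The original file over the frozen interface stays as it is.
-/

set_option autoImplicit false

universe u

open CategoryTheory Quiver

namespace Literature.AnabelianGeometry.AbsoluteAnabelian

variable {Vmod : Type u} {isArc : Vmod → Bool}

/-! ## Def 5.4 (vii), `TS`-half: `ι_{v,ε}` for every edge of `Γ⃗^log_v`

The index type `LogEdgeTS` of the `TS`-valued `ι_{v,ε}` (ALL edges of `Γ⃗^log_v`) and `LogEdge.toTS` are the ORIGINAL file's
(imported); `LogEdgeLtimes.toTS` is the successor interface's (`Ltimes/LogFrobeniusCompatibility.lean`). -/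

namespace LogFrobeniusSettingLtimes

variable (Lt : LogFrobeniusSettingLtimes Vmod isArc)

-- setting-independent declarations of the original file (namespace `LogFrobeniusSetting`), re-exposed under the
-- successor namespace (recipe rule 5): the portion `D•_{≤3}|_v`, its shape, arrows and boundary paths.
export LogFrobeniusSetting (InPortionThree core_mem_portion row1_mem_portion nplus_mem_portion logShapeTS lamEdgeTS
  forgetEdgeTS toCoreEdgeTS logEdgeTS lamPathTS postLogDomPathTS postLogCodPathTS)

/-- INTERFACE (Def 5.4 (vii), `TS`-valued half): "the arrow in the diagram of (iii) (respectively, (v)) corresponding to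
`ε` determines a natural transformation … `ι_{v,ε} : λ_{v,ν₁} ∘ Λ_{ν₁} → λ_{v,ν₂}`" for every edge `ε` of `Γ⃗^log_v`, where
`λ_{v,ν}` is `λ⊞_{v,ν}` composed with `𝒩⊞_v → 𝒩_v` (Def 5.4 (iv), (vi)); on the edges of `Γ⃗^⋉_v` it is `ι⊞_{v,ε}` pushed
down to `𝒩_v`. [cite: MochizukiAbsTopIII2015, Def 5.4 (vii) p. 128] -/
structure TSHomotopies : Type (u + 1) where
  /-- `ι_{v,ε}` for every edge `ε : ν₁ → ν₂` of `Γ⃗^log_v` -/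
  iota : ∀ (v : Vmod) {ν₁ ν₂ : LogVertex (isArc v)}, LogEdgeTS (isArc v) ν₁ ν₂ →
    ((frobeniusTwist Lt.log ν₁.isPostLog ⋙ Lt.lam v ν₁) ⋙ Lt.forget v ⟶ Lt.lam v ν₂ ⋙ Lt.forget v)
  /-- on `Γ⃗^⋉_v`, `ι_{v,ε}` is `ι⊞_{v,ε}` composed with `𝒩⊞_v → 𝒩_v` -/
  iota_toTS : ∀ (v : Vmod) {ν₁ ν₂ : LogVertex (isArc v)} (ε : LogEdgeLtimes (isArc v) ν₁ ν₂),
    iota v ε.toTS = Functor.whiskerRight (Lt.iota v ε) (Lt.forget v)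

/-! ## Cor 5.5 (iii), `TS`-half: the observable `S_log` at `v` -/

/-- the extended diagram carrying `S_log` at `v`. [cite: MochizukiAbsTopIII2015, Cor 5.5 (iii) p. 131] -/
abbrev logDiagramTS (v : Vmod) :=
  (Lt.subdiagram (InPortionThree v)).extend (Lt.obsExt (InPortionThree v) (.nv v))

/-- paraphrase of Cor 5.5 (iii) p. 131 ("respectively" reading): the `ι_{v,ε}` belong to a family of homotopies that
determines on the portion of `D•_{≤4}` indexed by `v` a structure of observable `S_log` on the portion of `D•_{≤3}` indexed by
`v` — as the predicate on a family of homotopies `H` of the extended diagram: (1) all boundary paths end at `𝒩_v`; (2) for every edge `ε : ν₁ → ν₂` of `Γ⃗^log_v` with `ν₁` pre-log the pair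
`([λ_{v,ν₁}], [λ_{v,ν₂}])` is a boundary pair whose homotopy is `ι_{v,ε}` (componentwise); (3) for `ε` leaving the post-log
vertex and every `⋎ ∈ L` the pair (`[λ_{v,space-link}] ∘ [id_⋎] ∘ [log]`, `[λ_{v,ν₂}] ∘ [id_{⋎+1}]`) is a boundary pair whose
homotopy is `ι_{v,ε}`. [cite: MochizukiAbsTopIII2015, Cor 5.5 (iii) p. 131] -/
def IsLogObservableTS (T : Lt.TSHomotopies) (v : Vmod) (H : (Lt.logDiagramTS v).HomotopyFamily) : Prop :=
  (∀ ⦃a b : (logShapeTS (isArc := isArc) v).Vertex⦄ ⦃p q : Path a b⦄, H.E p q →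
      b = (logShapeTS (isArc := isArc) v).obs) ∧
  (∀ (ν₁ ν₂ : LogVertex (isArc v)) (ε : LogEdgeTS (isArc v) ν₁ ν₂) (h₁ : ν₁.isPostLog = false)
      (h₂ : ν₂.isPostLog = false),
    ∃ hmem : H.E (lamPathTS v ν₁ h₁) (lamPathTS v ν₂ h₂),
      ∀ X₀ : Lt.X, ∃ (hobj : ((Lt.logDiagramTS v).pathFunctor (lamPathTS v ν₁ h₁)).obj X₀ =
          ((frobeniusTwist Lt.log ν₁.isPostLog ⋙ Lt.lam v ν₁) ⋙ Lt.forget v).obj X₀)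
        (hobj' : (Lt.lam v ν₂ ⋙ Lt.forget v).obj X₀ = ((Lt.logDiagramTS v).pathFunctor (lamPathTS v ν₂ h₂)).obj X₀),
        (H.η hmem).app X₀ = eqToHom hobj ≫ (T.iota v ε).app X₀ ≫ eqToHom hobj') ∧
  (∀ (ν₁ ν₂ : LogVertex (isArc v)) (ε : LogEdgeTS (isArc v) ν₁ ν₂) (h₁ : ν₁.isPostLog = true)
      (h₂ : ν₂.isPostLog = false) (hsl : (LogVertex.spaceLink (isArc v)).isPostLog = false) (n : ℤ),
    ∃ hmem : H.E (postLogDomPathTS v n hsl) (postLogCodPathTS v n ν₂ h₂),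
      ∀ X₀ : Lt.X, ∃ (hobj : ((Lt.logDiagramTS v).pathFunctor (postLogDomPathTS v n hsl)).obj X₀ =
          ((frobeniusTwist Lt.log ν₁.isPostLog ⋙ Lt.lam v ν₁) ⋙ Lt.forget v).obj X₀)
        (hobj' : (Lt.lam v ν₂ ⋙ Lt.forget v).obj X₀ = ((Lt.logDiagramTS v).pathFunctor (postLogCodPathTS v n ν₂ h₂)).obj X₀),
        (H.η hmem).app X₀ = eqToHom hobj ≫ (T.iota v ε).app X₀ ≫ eqToHom hobj')

/-- **Cor 5.5 (iii), `TS`-half** (assumption on `(L, T)`): for each `v ∈ V(F_mod)` the `ι_{v,ε}` belong to a family of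
homotopies determining an observable `S_log` on the portion of `D•_{≤3}` indexed by `v` (observation vertex `𝒩_v`).
[cite: MochizukiAbsTopIII2015, Cor 5.5 (iii) p. 131] -/
def Cor55ObservablesTS (T : Lt.TSHomotopies) : Prop :=
  ∀ v : Vmod, ∃ H : (Lt.logDiagramTS v).HomotopyFamily, Lt.IsLogObservableTS T v H

/-- **Cor 5.5 (iii), last sentence** (assumption on `(L, T)`): "the families of homotopies that constitute `S_log` and
`S_log⊞` are compatible with one another as well as with the families of homotopies that constitute the core and telecore
structures of (i), (ii)" — typed for the cores: all embed into one family of homotopies on `D•⊢` (compatibility with the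
telecore family of (ii): TODO(general form)). [cite: MochizukiAbsTopIII2015, Cor 5.5 (iii) p. 131] -/
def Cor55ObservablesCompatible (T : Lt.TSHomotopies) : Prop :=
  ∃ K : Lt.diagram.HomotopyFamily, Lt.RealisesCor55Families K ∧
    ∀ v : Vmod, ∃ H : (Lt.logDiagramTS v).HomotopyFamily, Lt.IsLogObservableTS T v H ∧ Lt.CompatibleIn K H

/-! ## Cor 5.5 (iv), first sentence: the log-wall, against both observables -/

/-- **Cor 5.5 (iv), first sentence** (the LOG-WALL, print-faithful form; assumption on `(L, T)`): "`D•_{≤2}` does not admit a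
structure of core on `D•_{≤1}` which [i.e., whose constituent family of homotopies] is compatible with [the constituent
families of homotopies of] the observables `S_log`, `S_log⊞` of (iii)" — no core structure on `D•_{≤1} ∪ {□}` embeds into one
family of homotopies on `D•⊢` together with observables `S_log⊞` AND `S_log` at every `v`. [cite: MochizukiAbsTopIII2015, Cor 5.5 (iv) p. 131] -/
def Cor55LogWall (T : Lt.TSHomotopies) : Prop :=
  ¬ ∃ (Hc : ((Lt.subdiagram (DVertex.InFirstRows 1)).extend (Lt.obsExt (DVertex.InFirstRows 1) .core)).HomotopyFamily)
      (hHc : ∀ ⦃a b : (obsShape (DVertex.InFirstRows (isArc := isArc) 1) DVertex.core).Vertex⦄ ⦃p q : Path a b⦄,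
        Hc.E p q → b = (obsShape (DVertex.InFirstRows (isArc := isArc) 1) DVertex.core).obs)
      (K : Lt.diagram.HomotopyFamily) (Hplus : ∀ v : Vmod, (Lt.logDiagramPlus v).HomotopyFamily)
      (Hts : ∀ v : Vmod, (Lt.logDiagramTS v).HomotopyFamily),
    (DiagramOfCategories.Observable.mk _ (fun _ => (inferInstance : IsEmpty PEmpty.{u + 1})) _ Hc hHc).IsCore ∧
      Lt.CompatibleIn K Hc ∧
      ∀ v : Vmod, (Lt.IsLogObservablePlus v (Hplus v) ∧ Lt.CompatibleIn K (Hplus v)) ∧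
        (Lt.IsLogObservableTS T v (Hts v) ∧ Lt.CompatibleIn K (Hts v))

/-- the print-faithful log-wall implies nothing weaker than — and is implied by — the `S_log⊞`-only form
`Cor55Incompatibility` of `LogFrobeniusCorollaries.lean` (fewer compatibility constraints there): the latter is the
stronger statement. [cite: MochizukiAbsTopIII2015, Cor 5.5 (iv) p. 131] -/
theorem cor55LogWall_of_incompatibility (T : Lt.TSHomotopies) (h : Lt.Cor55Incompatibility) : Lt.Cor55LogWall T := by
  rintro ⟨Hc, hHc, K, Hplus, Hts, hcore, hcK, hv⟩
  exact h ⟨Hc, hHc, K, Hplus, hcore, hcK, fun v => (hv v).1⟩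

end LogFrobeniusSettingLtimes

end Literature.AnabelianGeometry.AbsoluteAnabelian
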